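import Summits.QuantumFields.YangMills.Theorems.LangevinControlUVOSLegsFromFemtoAndGapDefsR3
import Summits.QuantumFields.YangMills.Theorems.LangevinControlUVOSLegsFromFemtoAndGapStubAssemblyRPPositivity
import Summits.QuantumFields.YangMills.Theorems.LangevinControlUVOSLegsAtWeakCouplingCStubRopeCutoff
import Summits.QuantumFields.YangMills.Theorems.PencilRigidityNPointIsotropyUnorderedRPTransport
import HarnessLib

/-!
# Stub `stub_rope` of line `Sketch` (crux `OSLegsAtWeakCouplingC`, stmt-QuantumFields-16207) — helper:
# reflection positivity on positive-time tuples (`RPPos`) of a soft-bundle limit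

Helper file for stub `stub_rope` (DefsR3 §4.4).  The `RPPos` half of the rope: E2 for finite tuples of positive-time
OFF-DIAGONAL test functions (not only time-ordered ones) along any soft bundle.  This is toolkit XXI
(`rp_nonneg_of_compactTime` / `isReflectionPositive_of_softLimit`) re-run with `IsPositiveTimeMulti ∧ IsOffDiagonal`
in place of `IsTimeOrdered`: the time-ordering is used there only (a) for the off-diagonality of the OS witnesses
`H i j = ΘFᵢ* ⊗ Fⱼ`, which for positive-time off-diagonal factors is `isOffDiagonal_osAdjoint_appendTensor`, and
(b) for the vanishing at non-positive times, which positive-time support gives; the density step uses the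
`⁰𝒮`-preserving compact cutoffs `exists_offDiagonal_cutoff_tendsto`.
* §1 `rp_nonneg_of_compactTime'`, `cutoff_props'`, `rpPos_of_softLimit` (scheme form);
* §2 `rpPos_of_softBundle'` (registered, bundle form);
* §3 `dependsOn_fieldObs_slab`: the smeared lattice field of a test function with lattice time support in `[1, w − 1]`
  depends only on the links based at lattice times `1 … w` (the slab hypothesis of the Hankel rope
  `norm_osCorr_timeShift_le_of_decay`, used by the `Decay` half of the stub).
Refs: OsterwalderSeiler1978 §2; OsterwalderSchrader1973 §3 (E2); GlimmJaffe1987 §6.1.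
-/

set_option autoImplicit false

noncomputable section

open scoped SchwartzMap BigOperators ComplexConjugate
open MeasureTheory Filter Topology
open Literature.MathematicalPhysics.QuantumFieldTheory Literature.MathematicalPhysics.QuantumLattice
open Literature.MathematicalPhysics.AQFT
open Literature.Probability.LatticeModels (box Site mem_box)
open Summit.QuantumFields.YangMills.Cruxes.OSLegsFromFemtoAndGap.DlrCollarTransfer
open Summit.QuantumFields.YangMills.Theorems.OSLegsFromFemtoAndGap
open Summit.QuantumFields.YangMills.Theorems.HypercubicLimit.Negative (val_proj_zero dependsOn_torusPlaquette)
open Summit.QuantumFields.YangMills.Theorems.NPointIsotropy.QuarterTurnCornerOperator.UnorderedRP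
  (isOffDiagonal_osAdjoint_appendTensor)

namespace Summit.QuantumFields.YangMills.Theorems.OSLegsAtWeakCouplingC

namespace RopeRP

variable {G : Type} [Group G] [TopologicalSpace G] [IsTopologicalGroup G] [CompactSpace G]
  [MeasurableSpace G] [BorelSpace G]

/-! ## §1 E2 on positive-time off-diagonal tuples along a scheme -/

-- adapted from toolkit XXI `rp_nonneg_of_compactTime` (`IsTimeOrdered` ↦ `IsPositiveTimeMulti ∧ IsOffDiagonal`)
/-- **Reflection positivity of the soft limit on compactly-time-supported positive-time off-diagonal tuples.** -/
theorem rp_nonneg_of_compactTime' (r : LatticeRep G) {βk : ℕ → ℝ} {Lk : ℕ → ℕ} {ak : ℕ → ℝ} {K : ℝ} (hK : 0 ≤ K)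
    (hβ : ∀ k, 0 ≤ βk k) (hL : ∀ k, 1 ≤ Lk k) (ha : ∀ k, 0 < ak k) (ha0 : Tendsto ak atTop (𝓝 0))
    (haL : Tendsto (fun k => ak k * Lk k) atTop atTop) (S₁ : SchwingerFamily (EuclideanSpace ℝ (Fin 4)))
    (hlim : ∀ (m : ℕ) (F : 𝓢((Fin m → (EuclideanSpace ℝ (Fin 4))), ℂ)), (2 ≤ m → IsOffDiagonal F) →
      Tendsto (fun k => latticeDist r.ρ (βk k) (Lk k) (ak k) r.curvature.F
        (wilsonTorusMean r.ρ (βk k) (Lk k) r.curvature.F) m F) atTop (𝓝 (S₁ m F)))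
    (hdef : ∀ (k m : ℕ), 2 ≤ m → ∀ rr : Fin m → Fin 4 × Fin 4, (∀ i, (rr i).1 < (rr i).2) →
      ∀ F : 𝓢((Fin m → (EuclideanSpace ℝ (Fin 4))), ℂ), IsOffDiagonal F → ∀ c : Fin m → (EuclideanSpace ℝ (Fin 4)), (∀ l, ‖c l‖ ≤ ak k) →
        ‖∑ z ∈ Fintype.piFinset (fun _ : Fin m => box 4 (Lk k)),
            ((torusMomentStr r.ρ (βk k) (Lk k) (fun i U => plaquetteObs r.ρ 0 (rr i).1 (rr i).2 U)
              (fun i => wilsonTorusMean r.ρ (βk k) (Lk k) (fun U => plaquetteObs r.ρ 0 (rr i).1 (rr i).2 U)) z : ℝ) : ℂ) *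
            (F ((fun l => ak k • siteToE (z l)) + c) - F (fun l => ak k • siteToE (z l)))‖ ≤
          2 * ‖c‖ * K ^ m * (SchwartzMap.seminorm ℂ 0 (4 * m + 1) F + SchwartzMap.seminorm ℂ (6 * m) (4 * m + 1) F +
            SchwartzMap.seminorm ℂ 0 1 F + SchwartzMap.seminorm ℂ (6 * m) 1 F + SchwartzMap.seminorm ℂ (10 * m) 1 F))
    {N : ℕ} {deg : Fin N → ℕ} (F : (j : Fin N) → 𝓢((Fin (deg j) → (EuclideanSpace ℝ (Fin 4))), ℂ)) (hF : ∀ j, IsPositiveTimeMulti (F j))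
    (hFo : ∀ j, IsOffDiagonal (F j))
    {T : ℝ} (hT : ∀ j (u : Fin (deg j) → (EuclideanSpace ℝ (Fin 4))), (∃ l, u l 0 ≤ 0 ∨ T < u l 0) → F j u = 0)
    (H : (i j : Fin N) → 𝓢((Fin (deg i + deg j) → (EuclideanSpace ℝ (Fin 4))), ℂ))
    (hH : ∀ i j, IsAppendTensorOf (H i j) (osAdjoint (F i)) (F j)) :
    let z := ∑ i, ∑ j, S₁ (deg i + deg j) (H i j)
    0 ≤ z.re ∧ z.im = 0 := by
  classical
  intro z
  -- off-diagonality of the witnesses (the only use of the time-ordering in toolkit XXI)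
  have hHeq : ∀ i j, H i j = (osAdjoint (F i)).appendTensor (F j) := fun i j => by
    ext x; rw [hH i j x, SchwartzMap.appendTensor_apply]
  have hHoff : ∀ i j, IsOffDiagonal (H i j) := fun i j => by
    rw [hHeq i j]; exact isOffDiagonal_osAdjoint_appendTensor (hF i) (hFo i) (hF j) (hFo j)
  -- the lattice OS forms and their limit
  set zk : ℕ → ℂ := fun k => ∑ i, ∑ j, latticeDist r.ρ (βk k) (Lk k) (ak k) r.curvature.F
    (wilsonTorusMean r.ρ (βk k) (Lk k) r.curvature.F) (deg i + deg j) (H i j) with hzk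
  have hz : Tendsto zk atTop (𝓝 z) :=
    tendsto_finsetSum _ fun i _ => tendsto_finsetSum _ fun j _ => hlim _ _ fun _ => hHoff i j
  -- the reflection-positivity squares
  set mk : ℕ → Fin 4 × Fin 4 → ℝ := fun k pl =>
    wilsonTorusMean r.ρ (βk k) (Lk k) (fun U => plaquetteObs r.ρ 0 pl.1 pl.2 U) with hmk
  set pk : ℕ → ℂ := fun k => wilsonExpectation (d := 4) (L := 2 * Lk k + 1) r.ρ (βk k) fun U =>
    conj (∑ j, fieldObs r (Lk k) (ak k) (F j) (mk k) U.timeReflect) * ∑ j, fieldObs r (Lk k) (ak k) (F j) (mk k) U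
    with hpk
  have hFvan : ∀ k j (y : Fin (deg j) → Site 4), (∃ l, y l 0 ≤ 0) → F j (fun l => ak k • siteToE (y l)) = 0 :=
    fun k j y ⟨l, hl⟩ => apply_eq_zero_of_time (ha k) (F j) (hT j) y ⟨l, Or.inl hl⟩
  have hp : ∀ᶠ k in atTop, 0 ≤ (pk k).re ∧ (pk k).im = 0 :=
    Eventually.of_forall fun k => rpSquare_fieldObs_nonneg r (hL k) (hβ k) (ak k) F (hFvan k) (mk k)
  -- P: the square as the shifted sum, for `T < aₖ Lₖ`
  set Pk : ℕ → Fin N → Fin N → ℂ := fun k i j =>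
    ∑ q ∈ Fintype.piFinset (fun _ : Fin (deg i) => Finset.univ.filter fun pl : Fin 4 × Fin 4 => pl.1 < pl.2),
      ∑ p ∈ Fintype.piFinset (fun _ : Fin (deg j) => Finset.univ.filter fun pl : Fin 4 × Fin 4 => pl.1 < pl.2),
      ∑ x ∈ Fintype.piFinset (fun _ : Fin (deg i) => box 4 (Lk k)),
      ∑ y ∈ Fintype.piFinset (fun _ : Fin (deg j) => box 4 (Lk k)),
        conj (F i (fun l => timeReflection 4 (ak k • siteToE (x (Fin.rev l))) +
            (ak k * (1 - if (q (Fin.rev l)).1 = 0 then 1 else 0)) • siteToE (Pi.single (0 : Fin 4) (1 : ℤ)))) *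
          F j (fun l => ak k • siteToE (y l)) *
          (torusMomentStr r.ρ (βk k) (Lk k)
            (fun l U => plaquetteObs r.ρ 0 (Fin.append q p l).1 (Fin.append q p l).2 U)
            (Fin.append (fun l => wilsonTorusMean r.ρ (βk k) (Lk k) (fun U => plaquetteObs r.ρ 0 (q l).1 (q l).2 U))
              (fun l => wilsonTorusMean r.ρ (βk k) (Lk k) (fun U => plaquetteObs r.ρ 0 (p l).1 (p l).2 U)))
            (Fin.append x y) : ℂ) with hPk
  have hpk_eq : ∀ᶠ k in atTop, pk k = ∑ i, ∑ j, Pk k i j := by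
    filter_upwards [haL.eventually_gt_atTop T] with k hk
    rw [hpk]
    dsimp only
    rw [wilsonExpectation_rpSquare_eq]
    refine Finset.sum_congr rfl fun i _ => Finset.sum_congr rfl fun j _ => ?_
    rw [rpTerm_eq_shifted r (βk k) (Lk k) (ha k) hk (F i) (hT i) (F j) (mk k)]
  -- Z − P = O(aₖ), pair by pair
  set Sp : Fin N → Fin N → ℝ := fun i j => SchwartzMap.seminorm ℂ 0 (4 * (deg i + deg j) + 1) (H i j) +
    SchwartzMap.seminorm ℂ (6 * (deg i + deg j)) (4 * (deg i + deg j) + 1) (H i j) + SchwartzMap.seminorm ℂ 0 1 (H i j) +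
    SchwartzMap.seminorm ℂ (6 * (deg i + deg j)) 1 (H i j) + SchwartzMap.seminorm ℂ (10 * (deg i + deg j)) 1 (H i j) with hSp
  set C : ℝ := ∑ i, ∑ j, 6 ^ deg i * 6 ^ deg j * (2 * K ^ (deg i + deg j) * Sp i j) with hC
  have hpair : ∀ k i j, ‖latticeDist r.ρ (βk k) (Lk k) (ak k) r.curvature.F
      (wilsonTorusMean r.ρ (βk k) (Lk k) r.curvature.F) (deg i + deg j) (H i j) - Pk k i j‖ ≤
      6 ^ deg i * 6 ^ deg j * (2 * ak k * K ^ (deg i + deg j) * Sp i j) := by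
    intro k i j
    refine norm_rpDefect_le r (βk k) (Lk k) (ha k).le hK (F i) (F j) (H i j) (hH i j) fun rr hrr c hc => ?_
    rcases Nat.lt_or_ge (deg i + deg j) 2 with h2 | h2
    · rw [defectSum_eq_zero_of_le_one r (βk k) (Lk k) (ak k) (by omega) rr (H i j) c, norm_zero]
      have : 0 ≤ Sp i j := by rw [hSp]; positivity
      positivity
    · exact hdef k _ h2 rr hrr (H i j) (hHoff i j) c hc
  have hnear : ∀ᶠ k in atTop, ‖zk k - pk k‖ ≤ ak k * C := by
    filter_upwards [hpk_eq] with k hk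
    rw [hk, hzk]
    dsimp only
    rw [← Finset.sum_sub_distrib]
    simp_rw [← Finset.sum_sub_distrib]
    calc _ ≤ ∑ i, ‖∑ j, (latticeDist r.ρ (βk k) (Lk k) (ak k) r.curvature.F
          (wilsonTorusMean r.ρ (βk k) (Lk k) r.curvature.F) (deg i + deg j) (H i j) - Pk k i j)‖ := norm_sum_le _ _
      _ ≤ ∑ i, ∑ j, 6 ^ deg i * 6 ^ deg j * (2 * ak k * K ^ (deg i + deg j) * Sp i j) :=
          Finset.sum_le_sum fun i _ => (norm_sum_le _ _).trans (Finset.sum_le_sum fun j _ => hpair k i j)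
      _ = ak k * C := by
          rw [hC, Finset.mul_sum]
          refine Finset.sum_congr rfl fun i _ => ?_
          rw [Finset.mul_sum]
          exact Finset.sum_congr rfl fun j _ => by ring
  have hε : Tendsto (fun k => ak k * C) atTop (𝓝 0) := by simpa using ha0.mul_const C
  exact nonneg_of_tendsto_of_near hz hp hε hnear

/-- Cutting off a positive-time test function inside a ball keeps it positive-time and gives it compact time support. -/
theorem cutoff_props' {m : ℕ} {F u : 𝓢((Fin m → (EuclideanSpace ℝ (Fin 4))), ℂ)} (hF : IsPositiveTimeMulti F) {R : ℝ}
    (hu : tsupport (u : (Fin m → (EuclideanSpace ℝ (Fin 4))) → ℂ) ⊆ tsupport (F : (Fin m → (EuclideanSpace ℝ (Fin 4))) → ℂ) ∩ Metric.closedBall 0 R) :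
    IsPositiveTimeMulti u ∧ ∀ x : Fin m → (EuclideanSpace ℝ (Fin 4)), (∃ l, x l 0 ≤ 0 ∨ R < x l 0) → u x = 0 := by
  refine ⟨(hu.trans Set.inter_subset_left).trans hF, fun x hx => ?_⟩
  by_contra hne
  have hmem : x ∈ tsupport (u : (Fin m → (EuclideanSpace ℝ (Fin 4))) → ℂ) := subset_tsupport _ hne
  obtain ⟨l, hl | hl⟩ := hx
  · exact absurd (hF (hu hmem).1 l) (not_lt.2 hl)
  · have h1 : ‖x‖ ≤ R := mem_closedBall_zero_iff.1 (hu hmem).2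
    have h2 : x l 0 ≤ ‖x‖ :=
      ((le_abs_self _).trans (by simpa using PiLp.norm_apply_le (x l) 0)).trans (norm_le_pi_norm x l)
    linarith

-- adapted from toolkit XXI `isReflectionPositive_of_softLimit` (density inside `⁰𝒮 ∩ 𝒮₊`)
/-- **`RPPos` of the soft limit along a scheme**: E2 on finite tuples of positive-time off-diagonal test functions, by
density of compactly supported ones (`exists_offDiagonal_cutoff_tendsto`) in `rp_nonneg_of_compactTime'`. -/
theorem rpPos_of_softLimit (r : LatticeRep G) {βk : ℕ → ℝ} {Lk : ℕ → ℕ} {ak : ℕ → ℝ} {K : ℝ}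
    (hK : 0 ≤ K) (hβ : ∀ k, 0 ≤ βk k) (hL : ∀ k, 1 ≤ Lk k) (ha : ∀ k, 0 < ak k) (ha0 : Tendsto ak atTop (𝓝 0))
    (haL : Tendsto (fun k => ak k * Lk k) atTop atTop) (S₁ : SchwingerFamily (EuclideanSpace ℝ (Fin 4)))
    (hlim : ∀ (m : ℕ) (F : 𝓢((Fin m → (EuclideanSpace ℝ (Fin 4))), ℂ)), (2 ≤ m → IsOffDiagonal F) →
      Tendsto (fun k => latticeDist r.ρ (βk k) (Lk k) (ak k) r.curvature.F
        (wilsonTorusMean r.ρ (βk k) (Lk k) r.curvature.F) m F) atTop (𝓝 (S₁ m F)))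
    (hdef : ∀ (k m : ℕ), 2 ≤ m → ∀ rr : Fin m → Fin 4 × Fin 4, (∀ i, (rr i).1 < (rr i).2) →
      ∀ F : 𝓢((Fin m → (EuclideanSpace ℝ (Fin 4))), ℂ), IsOffDiagonal F → ∀ c : Fin m → (EuclideanSpace ℝ (Fin 4)), (∀ l, ‖c l‖ ≤ ak k) →
        ‖∑ z ∈ Fintype.piFinset (fun _ : Fin m => box 4 (Lk k)),
            ((torusMomentStr r.ρ (βk k) (Lk k) (fun i U => plaquetteObs r.ρ 0 (rr i).1 (rr i).2 U)
              (fun i => wilsonTorusMean r.ρ (βk k) (Lk k) (fun U => plaquetteObs r.ρ 0 (rr i).1 (rr i).2 U)) z : ℝ) : ℂ) *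
            (F ((fun l => ak k • siteToE (z l)) + c) - F (fun l => ak k • siteToE (z l)))‖ ≤
          2 * ‖c‖ * K ^ m * (SchwartzMap.seminorm ℂ 0 (4 * m + 1) F + SchwartzMap.seminorm ℂ (6 * m) (4 * m + 1) F +
            SchwartzMap.seminorm ℂ 0 1 F + SchwartzMap.seminorm ℂ (6 * m) 1 F + SchwartzMap.seminorm ℂ (10 * m) 1 F)) :
    RPPos S₁ := by
  classical
  intro N deg F hF hFo H hH
  -- `⁰𝒮`-preserving compact cutoffs
  choose u hu_supp hu_off hu_lim using fun j => exists_offDiagonal_cutoff_tendsto (F j) (hFo j)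
  -- the approximating OS forms are non-negative
  have hstep : ∀ m : ℕ, let zm := ∑ i, ∑ j, S₁ (deg i + deg j) ((osAdjoint (u i m)).appendTensor (u j m))
      0 ≤ zm.re ∧ zm.im = 0 := by
    intro m
    have hprops := fun j => cutoff_props' (hF j) (hu_supp j m)
    exact rp_nonneg_of_compactTime' r hK hβ hL ha ha0 haL S₁ hlim hdef (fun j => u j m) (fun j => (hprops j).1)
      (fun j => hu_off j m) (T := 2 * ((m : ℝ) + 1)) (fun j x hx => (hprops j).2 x hx) _
      (fun i j x => SchwartzMap.appendTensor_apply _ _ x)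
  -- and converge to the OS form of `F`
  have hHeq : ∀ i j, H i j = (osAdjoint (F i)).appendTensor (F j) := fun i j => by
    ext x; rw [hH i j x, SchwartzMap.appendTensor_apply]
  have hconv : Tendsto (fun m => ∑ i, ∑ j, S₁ (deg i + deg j) ((osAdjoint (u i m)).appendTensor (u j m))) atTop
      (𝓝 (∑ i, ∑ j, S₁ (deg i + deg j) (H i j))) := by
    refine tendsto_finsetSum _ fun i _ => tendsto_finsetSum _ fun j _ => ?_
    rw [hHeq i j]
    exact ((S₁ (deg i + deg j)).continuous.tendsto _).comp
      (SchwartzMap.tendsto_appendTensor ((continuous_osAdjoint.tendsto _).comp (hu_lim i)) (hu_lim j))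
  have hre := (Complex.continuous_re.tendsto _).comp hconv
  have him := (Complex.continuous_im.tendsto _).comp hconv
  exact ⟨ge_of_tendsto' hre fun m => (hstep m).1,
    tendsto_nhds_unique him (tendsto_const_nhds.congr fun m => ((hstep m).2).symm)⟩

/-! ## §3 Slab support of the smeared field -/

omit [Group G] [TopologicalSpace G] [IsTopologicalGroup G] [CompactSpace G] [MeasurableSpace G] [BorelSpace G] in
/-- The four links of a plaquette based at a site `y` with `1 ≤ y⁰`, `y⁰ + 1 ≤ w ≤ 2L` are based at lattice times
`1 … w` of the torus of side `2L+1`. -/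
theorem plaquette_edges_subset_slab {L w : ℕ} (hwL : w ≤ 2 * L) {y : Site 4} (hy1 : 1 ≤ y 0) (hyw : y 0 + 1 ≤ w)
    {i j : Fin 4} (hij : i < j) :
    ({torusEdge (2 * L + 1) (y, i), torusEdge (2 * L + 1) (y + Pi.single i 1, j),
      torusEdge (2 * L + 1) (y + Pi.single j 1, i), torusEdge (2 * L + 1) (y, j)} : Set (Edge 4 (2 * L + 1))) ⊆
      {e : Edge 4 (2 * L + 1) | 1 ≤ (e.1 0).val ∧ (e.1 0).val ≤ w} := by
  obtain ⟨t, ht⟩ : ∃ t : ℕ, y 0 = t := ⟨(y 0).toNat, (Int.toNat_of_nonneg (by omega)).symm⟩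
  have ht1 : 1 ≤ t := by omega
  have htw : t + 1 ≤ w := by omega
  have hj0 : j ≠ 0 := fun h => by rw [h] at hij; exact absurd hij (Fin.not_lt.2 (Fin.zero_le _))
  have hy : (Literature.Probability.LatticeModels.Torus.proj (2 * L + 1) y 0).val = t := val_proj_zero ht (by omega)
  have hyj : (Literature.Probability.LatticeModels.Torus.proj (2 * L + 1) (y + Pi.single j 1) 0).val = t :=
    val_proj_zero (by simp [ht, Ne.symm hj0]) (by omega)
  intro e he
  simp only [Set.mem_insert_iff, Set.mem_singleton_iff] at he
  simp only [Set.mem_setOf_eq]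
  rcases he with rfl | rfl | rfl | rfl
  · simp only [torusEdge]; rw [hy]; exact ⟨ht1, by omega⟩
  · by_cases hi0 : i = 0
    · subst hi0
      have hy0 : (Literature.Probability.LatticeModels.Torus.proj (2 * L + 1) (y + Pi.single 0 1) 0).val = t + 1 :=
        val_proj_zero (t := t + 1) (by simp [ht]) (by omega)
      simp only [torusEdge]; rw [hy0]; exact ⟨by omega, htw⟩
    · have hyi : (Literature.Probability.LatticeModels.Torus.proj (2 * L + 1) (y + Pi.single i 1) 0).val = t :=
        val_proj_zero (by simp [ht, hi0]) (by omega)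
      simp only [torusEdge]; rw [hyi]; exact ⟨ht1, by omega⟩
  · simp only [torusEdge]; rw [hyj]; exact ⟨ht1, by omega⟩
  · simp only [torusEdge]; rw [hy]; exact ⟨ht1, by omega⟩

omit [IsTopologicalGroup G] [CompactSpace G] [BorelSpace G] in
/-- **Slab support of the string observable**: if every site has `1 ≤ y_l⁰`, `y_l⁰ + 1 ≤ w ≤ 2L`, `strObs` depends
only on the links based at lattice times `1 … w`. -/
theorem dependsOn_strObs_slab (r : LatticeRep G) {L w : ℕ} (hwL : w ≤ 2 * L) {n : ℕ} {q : Fin n → Fin 4 × Fin 4}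
    (hq : ∀ l, (q l).1 < (q l).2) (m : Fin n → ℝ) {y : Fin n → Site 4} (hy : ∀ l, 1 ≤ y l 0 ∧ y l 0 + 1 ≤ w) :
    DependsOn (strObs r L q m y) {e : Edge 4 (2 * L + 1) | 1 ≤ (e.1 0).val ∧ (e.1 0).val ≤ w} := by
  intro U V hUV
  unfold strObs
  refine Finset.prod_congr rfl fun l _ => ?_
  rw [plane_torusLift, plane_torusLift]
  congr 1
  exact dependsOn_torusPlaquette r (2 * L + 1) (q l).1 (q l).2 (y l) fun e he =>
    hUV e (plaquette_edges_subset_slab hwL (hy l).1 (hy l).2 (hq l) he)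

omit [IsTopologicalGroup G] [CompactSpace G] [BorelSpace G] in
/-- **Slab support of the smeared field**: if `F(a y) ≠ 0` forces `1 ≤ y_l⁰` and `y_l⁰ + 1 ≤ w` (`w ≤ 2L`) for every
site, the smeared field `fieldObs r L a F m` depends only on the links based at lattice times `1 … w`. -/
theorem dependsOn_fieldObs_slab (r : LatticeRep G) {L w : ℕ} (hwL : w ≤ 2 * L) (a : ℝ) {n : ℕ}
    (F : 𝓢((Fin n → (EuclideanSpace ℝ (Fin 4))), ℂ))
    (hF : ∀ y : Fin n → Site 4, F (fun l => a • siteToE (y l)) ≠ 0 → ∀ l, 1 ≤ y l 0 ∧ y l 0 + 1 ≤ w)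
    (m : Fin 4 × Fin 4 → ℝ) :
    DependsOn (fieldObs r L a F m) {e : Edge 4 (2 * L + 1) | 1 ≤ (e.1 0).val ∧ (e.1 0).val ≤ w} := by
  intro U V hUV
  unfold fieldObs
  refine Finset.sum_congr rfl fun q hq => Finset.sum_congr rfl fun y _ => ?_
  by_cases h0 : F (fun l => a • siteToE (y l)) = 0
  · rw [h0, zero_mul, zero_mul]
  · rw [dependsOn_strObs_slab r hwL ((mem_planeStrings_iff'' q).1 hq) _ (hF y h0) hUV]

end RopeRP

/-! ## §2 The bundle form -/

open RopeRP in
/-- **`RPPos` of a soft-bundle limit** (registered helper of `stub_rope`): along any soft bundle the limit family is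
reflection positive on finite tuples of positive-time off-diagonal test functions — Osterwalder–Seiler positivity
of the odd torus through the square expansion (toolkits XVII–XX), `O(a_k)` defects by the bundle's shift-defect
bound, and density of compactly supported tuples inside `⁰𝒮 ∩ 𝒮₊`. -/
theorem rpPos_of_softBundle' : ∀ {G : Type} [Group G] [TopologicalSpace G] [IsTopologicalGroup G] [CompactSpace G] [MeasurableSpace G] [BorelSpace G] {r : LatticeRep G} {a : ℝ → ℝ}, (∀ β, 0 < a β) → Filter.Tendsto a Filter.atTop (nhds 0) → ∀ {sch : SpeciesScheme (YMSpecies G)} {S₁ : SchwingerFamily (EuclideanSpace ℝ (Fin 4))} {Tq : (n : ℕ) → (Fin n → Fin 4 × Fin 4) → (SchwartzMap (Fin n → EuclideanSpace ℝ (Fin 4)) ℂ →L[ℂ] ℂ)} {K : ℝ} {b₀ : ℝ} {g : ℝ → ℕ → ℕ}, Summit.QuantumFields.YangMills.Cruxes.OSLegsFromFemtoAndGap.DlrCollarTransfer.SoftBundle G r a sch S₁ Tq K b₀ g → Summit.QuantumFields.YangMills.Cruxes.OSLegsFromFemtoAndGap.DlrCollarTransfer.RPPos S₁ := by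
  intro G _ _ _ _ _ _ r a _ _ sch S₁ Tq K b₀ g hB
  obtain ⟨⟨-, -, -, -, -, -, -, -, h9, h10, h11, h12, -, -, -, -, h17, -, h19, -, -⟩, -⟩ := hB
  refine rpPos_of_softLimit r h12.1 (fun k => (h17 k).1) (fun k => le_trans (by norm_num) (h17 k).2.2.1) sch.a_pos
    sch.tendsto_a sch.tendsto_L S₁ (fun m F hF => ?_) h19
  rcases Nat.lt_or_ge m 2 with hm | hm
  · interval_cases m
    · simp_rw [latticeDist_zero_apply r.ρ r.continuous, h9]; exact tendsto_const_nhds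
    · simp_rw [latticeDist_one_apply, h10]; exact tendsto_const_nhds
  · exact h11 m hm F (hF hm)

end Summit.QuantumFields.YangMills.Theorems.OSLegsAtWeakCouplingC

end
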